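import Literature.Probability.RandomPlanarGeometry.HexSAWSurfaceWallRenewalTwelfthCensusIdentity
import Literature.Probability.RandomPlanarGeometry.HexSAWSurfaceWallRenewalCensusTwelveA
import Literature.Probability.RandomPlanarGeometry.HexSAWSurfaceWallRenewalCensusTwelveB
import Literature.Probability.RandomPlanarGeometry.HexSAWSurfaceWallRenewalCensusTwelveC
import Literature.Probability.RandomPlanarGeometry.HexSAWSurfaceWallRenewalSixStepRigid
import HarnessLib

/-!
# The twelfth-order coefficient of `β(y)²` is minus one hundred and nine:
# `y¹¹ (β(y)² − y − 1/y − 1/y² − 2/y³ − 4/y⁴ − 6/y⁵ − 12/y⁶ − 18/y⁷ − 15/y⁸ − 7/y⁹ + 16/y¹⁰) → −109`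

`β(y) = wallRate y` is the exponential growth rate of wall bridges of self-avoiding walks on the brick-wall (hexagonal) lattice along a zigzag wall with
contact fugacity `y`.  «TWELFTH-CENSUS-IDENTITY» identifies the twelfth coefficient with `N₁₃,₁ + N₁₄,₂ + N₁₅,₃ + N₁₆,₄ + N₁₇,₅ + N₁₈,₆ − 21300`; this module
substitutes `5975`, `7718`, `260` («CENSUS-TWELVE-A»), `5219` («CENSUS-TWELVE-B»), `2018` («CENSUS-TWELVE-C») — this seat's FAST counting engine — and
`N₁₈,₆ = 1` from the six-step rigidity (CAR 73, `card_filter_six_mul_visits_eq`: the hook `H₆`):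

  ★★★ `tendsto_pow_eleven_mul_wallRate_sq_sub : y¹¹ (β(y)² − y − … − 7/y⁹ + 16/y¹⁰) → −109` (`y → ∞`),

i.e. **`β(y)² = y + 1/y + 1/y² + 2/y³ + 4/y⁴ + 6/y⁵ + 12/y⁶ + 18/y⁷ + 15/y⁸ + 7/y⁹ − 16/y¹⁰ − 109/y¹¹ + o(y⁻¹¹)`** — the second negative coefficient of the
strong-adsorption expansion (`isLittleO_wallRate_sq_sub_twelfth`, `eventually_twelfth_order_window`, `tendsto_pow_eleven_mul_wallRate_sq_sub_unique`,
`twelfth_coefficient_neg`).  a-p6 g21's series inversion of Kesten's identity and FIRST-A a-ref-2 g59 / a-ref-1 g68 independently predicted exactly `a₁₁ = −109`.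

HONEST LABEL.  LANE THEOREM, DERIVED (one-line assembly); NEW IN WRITING (modest).  Print: `β ∼ √y` ([BeatonBousquetMelouDeGierDuminilCopinGuttmann2014, §3.1, Proposition 5, p. 10]),
renewal structure ([MadrasSlade1993, §4.2], [Kesten1963SAW, §4]).  NOT CLAIMED: `a₁₂`, any rate, anything for `y ≤ μ³`.  No definitions.
-/

namespace Literature.Probability.RandomPlanarGeometry.SAW.HexBW.Wall

open Finset Filter Function
open Literature.Probability.LatticeModels
open _root_.Topology Asymptotics

variable {y : ℝ}

/-- [folklore] Relabel the limit of a `Tendsto` by an equal constant. -/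
private theorem tendsto_of_tendsto_of_eq_tx {f : ℝ → ℝ} {L c : ℝ} (h : Tendsto f atTop (𝓝 L)) (e : L = c) :
    Tendsto f atTop (𝓝 c) := e ▸ h

open Classical in
/-- `N₁₈,₆ = 1` at the numeral length: the six-visit irreducible positive wall bridges of length `36` are the single hook `H₆` (six-step rigidity, CAR 73).
[cite: MadrasSlade1993, Section 4.2, remark before (4.2.21) (p. 94)] -/
theorem card_sixVisit_ipwb_thirtysix_eq {m : ℕ} (hm : m = 36) : #((ipwb m).filter fun ω => visits m ω = 6) = 1 := by
  have h := card_filter_six_mul_visits_eq (n := m) (by omega)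
  rw [if_pos (show 6 ∣ m from ⟨6, by omega⟩)] at h
  rw [← h]
  refine congrArg Finset.card (Finset.filter_congr fun ω _ => ?_)
  omega

/-- ★★★ **THE TWELFTH-ORDER COEFFICIENT OF `β(y)²` IS `−109`:**
`y¹¹ (β(y)² − y − … − 7/y⁹ + 16/y¹⁰) → −109` as `y → ∞` — the census identity with `5975 + 7718 + 5219 + 2018 + 260 + 1 = 21191` and `21191 − 21300 = −109`.
[cite: BeatonBousquetMelouDeGierDuminilCopinGuttmann2014, Section 3.1, Proposition 5 (arXiv v5 p. 9); p. 10] [cite: Kesten1963SAW, Section 4] [cite: MadrasSlade1993, Section 4.2, (4.2.4), Theorem 4.2.2 (pp. 91–92)] -/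
theorem tendsto_pow_eleven_mul_wallRate_sq_sub :
    Tendsto (fun y : ℝ => y ^ 11 * (wallRate y ^ 2 - y - 1 / y - 1 / y ^ 2 - 2 / y ^ 3 - 4 / y ^ 4 - 6 / y ^ 5 - 12 / y ^ 6 - 18 / y ^ 7 - 15 / y ^ 8 - 7 / y ^ 9 +
      16 / y ^ 10)) atTop (𝓝 (-109)) := by
  classical
  have h := tendsto_pow_eleven_mul_wallRate_sq_sub_census (m₁ := 26) (m₂ := 28) (m₃ := 30) (m₄ := 32) (m₅ := 34) (m₆ := 36) rfl rfl rfl rfl rfl rfl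
  rw [card_oneVisit_ipwb_twentysix_eq rfl, card_twoVisit_ipwb_twentyeight_eq rfl, card_threeVisit_ipwb_thirty_eq rfl,
    card_fourVisit_ipwb_thirtytwo_eq rfl, card_fiveVisit_ipwb_thirtyfour_eq rfl, card_sixVisit_ipwb_thirtysix_eq rfl] at h
  exact tendsto_of_tendsto_of_eq_tx h (by norm_num)

/-- ★★★ Landau form: `β(y)² − (y + 1/y + … + 7/y⁹ − 16/y¹⁰ − 109/y¹¹) = o(y⁻¹¹)` as `y → ∞`.
[cite: BeatonBousquetMelouDeGierDuminilCopinGuttmann2014, Section 3.1, Proposition 5 (arXiv v5 p. 9)] -/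
theorem isLittleO_wallRate_sq_sub_twelfth :
    (fun y : ℝ => wallRate y ^ 2 - (y + 1 / y + 1 / y ^ 2 + 2 / y ^ 3 + 4 / y ^ 4 + 6 / y ^ 5 + 12 / y ^ 6 + 18 / y ^ 7 + 15 / y ^ 8 + 7 / y ^ 9 - 16 / y ^ 10 -
      109 / y ^ 11)) =o[atTop] fun y : ℝ => 1 / y ^ 11 := by
  have h0 : Tendsto (fun y : ℝ => y ^ 11 * (wallRate y ^ 2 - y - 1 / y - 1 / y ^ 2 - 2 / y ^ 3 - 4 / y ^ 4 - 6 / y ^ 5 - 12 / y ^ 6 - 18 / y ^ 7 - 15 / y ^ 8 -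
      7 / y ^ 9 + 16 / y ^ 10) - (-109)) atTop (𝓝 0) := by
    simpa using tendsto_pow_eleven_mul_wallRate_sq_sub.sub_const (-109)
  have h1 : (fun y : ℝ => y ^ 11 * (wallRate y ^ 2 - y - 1 / y - 1 / y ^ 2 - 2 / y ^ 3 - 4 / y ^ 4 - 6 / y ^ 5 - 12 / y ^ 6 - 18 / y ^ 7 - 15 / y ^ 8 -
      7 / y ^ 9 + 16 / y ^ 10) - (-109)) =o[atTop] fun _ : ℝ => (1 : ℝ) := (isLittleO_one_iff ℝ).2 h0
  have h2 := h1.mul_isBigO (isBigO_refl (fun y : ℝ => 1 / y ^ 11) atTop)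
  refine (h2.congr' ?_ ?_)
  · filter_upwards [eventually_gt_atTop (0 : ℝ)] with y hy
    field_simp
    ring
  · exact Eventually.of_forall fun y => by simp

/-- ★★ Two-sided eventual form: for every `δ > 0`, eventually
`y + 1/y + … − 16/y¹⁰ + (−109 − δ)/y¹¹ ≤ β(y)² ≤ y + 1/y + … − 16/y¹⁰ + (−109 + δ)/y¹¹`.
[cite: BeatonBousquetMelouDeGierDuminilCopinGuttmann2014, Section 3.1, Proposition 5 (arXiv v5 p. 9)] -/
theorem eventually_twelfth_order_window {δ : ℝ} (hδ : 0 < δ) :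
    ∀ᶠ y : ℝ in atTop, y + 1 / y + 1 / y ^ 2 + 2 / y ^ 3 + 4 / y ^ 4 + 6 / y ^ 5 + 12 / y ^ 6 + 18 / y ^ 7 + 15 / y ^ 8 + 7 / y ^ 9 - 16 / y ^ 10 +
        (-109 - δ) / y ^ 11 ≤ wallRate y ^ 2 ∧
      wallRate y ^ 2 ≤ y + 1 / y + 1 / y ^ 2 + 2 / y ^ 3 + 4 / y ^ 4 + 6 / y ^ 5 + 12 / y ^ 6 + 18 / y ^ 7 + 15 / y ^ 8 + 7 / y ^ 9 - 16 / y ^ 10 +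
        (-109 + δ) / y ^ 11 := by
  have h := tendsto_pow_eleven_mul_wallRate_sq_sub
  have hlo := h.eventually (eventually_gt_nhds (show (-109 : ℝ) - δ < -109 by linarith))
  have hhi := h.eventually (eventually_lt_nhds (show (-109 : ℝ) < -109 + δ by linarith))
  filter_upwards [hlo, hhi, eventually_gt_atTop (0 : ℝ)] with y h1 h2 hy
  have hy8 : 0 < y ^ 11 := pow_pos hy 11
  have e2 : wallRate y ^ 2 = (y + 1 / y + 1 / y ^ 2 + 2 / y ^ 3 + 4 / y ^ 4 + 6 / y ^ 5 + 12 / y ^ 6 + 18 / y ^ 7 + 15 / y ^ 8 + 7 / y ^ 9 - 16 / y ^ 10) +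
      (y ^ 11 * (wallRate y ^ 2 - y - 1 / y - 1 / y ^ 2 - 2 / y ^ 3 - 4 / y ^ 4 - 6 / y ^ 5 - 12 / y ^ 6 - 18 / y ^ 7 - 15 / y ^ 8 - 7 / y ^ 9 +
        16 / y ^ 10)) / y ^ 11 := by
    field_simp
    ring
  have elo : y + 1 / y + 1 / y ^ 2 + 2 / y ^ 3 + 4 / y ^ 4 + 6 / y ^ 5 + 12 / y ^ 6 + 18 / y ^ 7 + 15 / y ^ 8 + 7 / y ^ 9 - 16 / y ^ 10 + (-109 - δ) / y ^ 11 =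
      (y + 1 / y + 1 / y ^ 2 + 2 / y ^ 3 + 4 / y ^ 4 + 6 / y ^ 5 + 12 / y ^ 6 + 18 / y ^ 7 + 15 / y ^ 8 + 7 / y ^ 9 - 16 / y ^ 10) + (-109 - δ) / y ^ 11 := by
    ring
  have ehi : y + 1 / y + 1 / y ^ 2 + 2 / y ^ 3 + 4 / y ^ 4 + 6 / y ^ 5 + 12 / y ^ 6 + 18 / y ^ 7 + 15 / y ^ 8 + 7 / y ^ 9 - 16 / y ^ 10 + (-109 + δ) / y ^ 11 =
      (y + 1 / y + 1 / y ^ 2 + 2 / y ^ 3 + 4 / y ^ 4 + 6 / y ^ 5 + 12 / y ^ 6 + 18 / y ^ 7 + 15 / y ^ 8 + 7 / y ^ 9 - 16 / y ^ 10) + (-109 + δ) / y ^ 11 := by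
    ring
  rw [elo, ehi, e2]
  constructor
  · gcongr
  · gcongr

/-- ★ Uniqueness form: any limit of `y¹¹ (β(y)² − y − … + 16/y¹⁰)` equals `−109`. [cite: MadrasSlade1993, Section 4.2, Theorem 4.2.2 (pp. 91–92)] -/
theorem tendsto_pow_eleven_mul_wallRate_sq_sub_unique {L : ℝ}
    (h : Tendsto (fun y : ℝ => y ^ 11 * (wallRate y ^ 2 - y - 1 / y - 1 / y ^ 2 - 2 / y ^ 3 - 4 / y ^ 4 - 6 / y ^ 5 - 12 / y ^ 6 - 18 / y ^ 7 - 15 / y ^ 8 -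
      7 / y ^ 9 + 16 / y ^ 10)) atTop (𝓝 L)) :
    L = -109 :=
  tendsto_nhds_unique h tendsto_pow_eleven_mul_wallRate_sq_sub

/-- ★★ **The twelfth coefficient is negative, like the eleventh**: any limit of `y¹¹ (β² − y − … + 16/y¹⁰)` is `< 0`
(sequence `1, 1, 2, 4, 6, 12, 18, 15, 7, −16, −109`). [cite: BeatonBousquetMelouDeGierDuminilCopinGuttmann2014, Section 3.1, Proposition 5 (arXiv v5 p. 9); p. 10] -/
theorem twelfth_coefficient_neg {L : ℝ}
    (h : Tendsto (fun y : ℝ => y ^ 11 * (wallRate y ^ 2 - y - 1 / y - 1 / y ^ 2 - 2 / y ^ 3 - 4 / y ^ 4 - 6 / y ^ 5 - 12 / y ^ 6 - 18 / y ^ 7 - 15 / y ^ 8 -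
      7 / y ^ 9 + 16 / y ^ 10)) atTop (𝓝 L)) : L < 0 := by
  rw [tendsto_pow_eleven_mul_wallRate_sq_sub_unique h]
  norm_num

end Literature.Probability.RandomPlanarGeometry.SAW.HexBW.Wall
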